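import Summits.RiemannHypothesis.RiemannHypothesis.Theorems.SignConeConeMagnificationCombTypePair
import Summits.RiemannHypothesis.RiemannHypothesis.Theorems.SignConeConeMagnificationDesignClasses
import Literature.NumberTheory.LFunctions.ClassSumsConverge
import Literature.NumberTheory.LFunctions.TypeLimitsExist

/-!
# Crux `SignCone.ConeMagnification` (stmt-RiemannHypothesis-16303), line `Sketch` r9, stub `stub_combType` — assembly, part 2:
# the per-pair evaluation from PAIR-LEVEL data (interface for `pair_difference_bound`-shaped lemmas)

Seat-0's half of the agreed split (lead c1, 09:03Z 08-17): the lead's wave 3 proves the c-free SHARP node evaluation of the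
`ζ`-mollified comb (Literature); this file turns [comb inequality (`comb_inequality_design`, p149415)] + [node data] into the type
inequality for a real finitely supported design `β`, via the class decomposition of the deep-zone term
(`CombType.sum_dvd_indicator_div_eq`), the harmonic cut-off weights (`…CombTypeWeights`), the referee's class machinery
(`TypeDesign.sum_mul_re_gcdForm_eq_sum_gcdClasses`, `gcdClassSum_converges`, `tendsto_sum_mul_weight_of_tendsto`), and division by
`B(0) log M`.

`typeBound_of_nodeData`: hypotheses — unit slack, `c ≥ 0`, local summability, the Mertens difference `Σ_{n<N}(c−Λ)(n)/n → C₁`,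
a smooth real bump `b` on `[-1,1]`, a constant `B₀ > 0`, and the NODE DATA: eventually in `M`, for every pair `ℓ, ℓ' ≤ L`, the node weights
`V_M(ℓ,ℓ',n)` (the explicit double sums of `comb_inequality_design`) decompose on `1 ≤ n ≤ 3LM` as
`B₀√(ℓ/ℓ')·(Σ_{k' ≤ ⌊X_M/(nℓ')⌋}[ℓ ∣ nℓ'k']/k')/n + S(gcd(nℓ',ℓ))/n + Sm(n) + e(n)` (`X_M = M/(4√(log M))`) with
`|S| ≤ C(log M)^θ`, `|Σ (c−Λ) Sm| ≤ C(log M)^θ`, `Σ (c+Λ)|e| ≤ C(log M)^θ`, and `|V_M(ℓ,ℓ',1) − B₀(gcd(ℓ',ℓ)/√(ℓℓ')) log M| ≤ C(log M)^θ`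
for some `C` and `θ < 1`; conclusion — the limit `T` of the type partial sums of `β` satisfies `T ≤ ½ Re Φ_β(1)`.
-/

noncomputable section

-- `Summit.RiemannHypothesis.RiemannHypothesis.…` repeats a namespace component by design (D-0017 layout).
set_option linter.dupNamespace false

open scoped BigOperators ComplexConjugate Topology ArithmeticFunction.vonMangoldt ContDiff
open Complex MeasureTheory Set Filter

namespace Summit.RiemannHypothesis.RiemannHypothesis.Theorems.SignConeConeMagnification

open Literature.NumberTheory.LFunctions
open Literature.NumberTheory.LFunctions.GcdForm (gcdForm)

namespace CombType

/-! ### The per-pair evaluation from pair-level data -/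

/-- **Per-pair evaluation from PAIR DATA** `|D − A| ≤ E`: for one pair `(ℓ, ℓ')` at level `M`, given directly the pair-level bound
`|Σ c V − Σ Λ V − Σ (c−Λ)(n)(B₀√(ℓ/ℓ')D(n)/n + S(gcd)/n)| ≤ Cst(log M)^θ` (the shape of the lead's `pair_difference_bound`) instead of the node decomposition
`V(n) = B₀√(ℓ/ℓ')·(Σ_{k'≤⌊X/(nℓ')⌋}[ℓ∣nℓ'k']/k')/n + S(gcd(nℓ',ℓ))/n + Sm(n) + e(n)` on `[1, 3LM]` with `|S| ≤ Cst(log M)^θ`,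
`|Σ(c−Λ)Sm| ≤ Cst(log M)^θ`, `Σ(c+Λ)|e| ≤ Cst(log M)^θ`, and bounded class partial sums `|Σ_{n<N} ((c−Λ)(n)/n)1[gcd=δ]| ≤ K δ`:
the difference of the node sums `Σ c V − Σ Λ V` is within `(Cst ΣK + Cst + Cst)(log M)^θ` of the weighted class sum
`B₀ log M · Σ_{δ∣ℓ} (δ/√(ℓℓ')) Σ_{n ≤ 3LM} ((c−Λ)(n)/n) 1[gcd(nℓ',ℓ)=δ] H(⌊X/(nℓ')⌋/(ℓ/δ))/log M`. [folklore] -/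
theorem pair_bound_of_pairData {c : ℕ → ℝ} {L M ℓ ℓ' : ℕ} (hℓ : ℓ ∈ Finset.Icc 1 L) (hℓ' : ℓ' ∈ Finset.Icc 1 L)
    (hlog : 0 < Real.log M)
    {B₀ Cst θ : ℝ} (V : ℕ → ℕ → ℕ → ℕ → ℝ) (S : ℕ → ℝ) (hS : ∀ δ, |S δ| ≤ Cst * Real.log M ^ θ)
    (hpd : |((∑ n ∈ Finset.Icc 1 (3 * L * M), c n * V M ℓ ℓ' n) - ∑ n ∈ Finset.Icc 1 (3 * L * M), (Λ n : ℝ) * V M ℓ ℓ' n) -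
        ∑ n ∈ Finset.Icc 1 (3 * L * M), (c n - Λ n) *
          (B₀ * (Real.sqrt ℓ / Real.sqrt ℓ') *
              (∑ k' ∈ Finset.Icc 1 (⌊(M : ℝ) / (4 * Real.sqrt (Real.log M)) / ((n : ℝ) * ℓ')⌋₊),
                (if ℓ ∣ n * ℓ' * k' then (1 : ℝ) / k' else 0)) / n +
            S (Nat.gcd (n * ℓ') ℓ) / n)| ≤ Cst * Real.log M ^ θ)
    (K : ℕ → ℝ) (hK : ∀ δ N, |∑ n ∈ Finset.range N,
      (c n - Λ n) / n * (if Nat.gcd (n * ℓ') ℓ = δ then (1 : ℝ) else 0)| ≤ K δ) :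
    |((∑ n ∈ Finset.Icc 1 (3 * L * M), c n * V M ℓ ℓ' n) - ∑ n ∈ Finset.Icc 1 (3 * L * M), (Λ n : ℝ) * V M ℓ ℓ' n) -
        B₀ * Real.log M * (∑ δ ∈ ℓ.divisors, (δ : ℝ) / Real.sqrt ((ℓ : ℝ) * ℓ') *
          ∑ n ∈ Finset.range (3 * L * M + 1), (c n - Λ n) / n * (if Nat.gcd (n * ℓ') ℓ = δ then (1 : ℝ) else 0) *
            ((∑ j ∈ Finset.Icc 1 (⌊(M : ℝ) / (4 * Real.sqrt (Real.log M)) / ((max n 1 : ℕ) * ℓ')⌋₊ / (ℓ / δ)),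
              (1 : ℝ) / j) / Real.log M))| ≤
      (Cst * (∑ δ ∈ ℓ.divisors, K δ) + Cst + Cst) * Real.log M ^ θ := by
  classical
  set d : ℕ → ℝ := fun n => (c n - Λ n) / n with hd
  set ind : ℕ → ℕ → ℕ → ℕ → ℝ := fun ℓ ℓ' δ n => if Nat.gcd (n * ℓ') ℓ = δ then (1 : ℝ) else 0 with hind
  set X : ℕ → ℝ := fun M => (M : ℝ) / (4 * Real.sqrt (Real.log M)) with hX
  set w : ℕ → ℕ → ℕ → ℕ → ℕ → ℝ := fun ℓ ℓ' δ M n =>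
    (∑ j ∈ Finset.Icc 1 (⌊X M / ((max n 1 : ℕ) * ℓ')⌋₊ / (ℓ / δ)), (1 : ℝ) / j) / Real.log M with hw
  show |((∑ n ∈ Finset.Icc 1 (3 * L * M), c n * V M ℓ ℓ' n) - ∑ n ∈ Finset.Icc 1 (3 * L * M), (Λ n : ℝ) * V M ℓ ℓ' n) -
        B₀ * Real.log M * (∑ δ ∈ ℓ.divisors, (δ : ℝ) / Real.sqrt ((ℓ : ℝ) * ℓ') *
          ∑ n ∈ Finset.range (3 * L * M + 1), d n * ind ℓ ℓ' δ n * w ℓ ℓ' δ M n)| ≤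
      (Cst * (∑ δ ∈ ℓ.divisors, K δ) + Cst + Cst) * Real.log M ^ θ
  have hℓ1 := (Finset.mem_Icc.1 hℓ).1
  have hℓ'1 := (Finset.mem_Icc.1 hℓ').1
  -- (1) the deep term is the weighted class sum
  have hdeep : ∑ n ∈ Finset.Icc 1 (3 * L * M), (c n - Λ n) *
        (B₀ * (Real.sqrt ℓ / Real.sqrt ℓ') *
            (∑ k' ∈ Finset.Icc 1 (⌊(M : ℝ) / (4 * Real.sqrt (Real.log M)) / ((n : ℝ) * ℓ')⌋₊),
              (if ℓ ∣ n * ℓ' * k' then (1 : ℝ) / k' else 0)) / n) =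
      B₀ * Real.log M * (∑ δ ∈ ℓ.divisors, (δ : ℝ) / Real.sqrt ((ℓ : ℝ) * ℓ') *
        ∑ n ∈ Finset.range (3 * L * M + 1), d n * ind ℓ ℓ' δ n * w ℓ ℓ' δ M n) := by
    -- rewrite each summand via the class identity and insert `Σ_δ 1[g_n = δ] = 1`
    have hterm : ∀ n ∈ Finset.Icc 1 (3 * L * M), (c n - Λ n) *
        (B₀ * (Real.sqrt ℓ / Real.sqrt ℓ') *
            (∑ k' ∈ Finset.Icc 1 (⌊(M : ℝ) / (4 * Real.sqrt (Real.log M)) / ((n : ℝ) * ℓ')⌋₊),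
              (if ℓ ∣ n * ℓ' * k' then (1 : ℝ) / k' else 0)) / n) =
        B₀ * Real.log M * ∑ δ ∈ ℓ.divisors, (δ : ℝ) / Real.sqrt ((ℓ : ℝ) * ℓ') *
          (d n * ind ℓ ℓ' δ n * w ℓ ℓ' δ M n) := by
      intro n hn
      have hn1 := (Finset.mem_Icc.1 hn).1
      rw [mul_assoc B₀, deep_term_eq hℓ1 hℓ'1]
      -- the class of `n`
      set g := Nat.gcd (n * ℓ') ℓ with hg
      have hgmem : g ∈ ℓ.divisors := Nat.mem_divisors.2 ⟨Nat.gcd_dvd_right _ _, by omega⟩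
      rw [← Finset.sum_filter_add_sum_filter_not ℓ.divisors (fun δ => δ = g)]
      have hfilter : ℓ.divisors.filter (fun δ => δ = g) = {g} := by
        ext δ
        simp only [Finset.mem_filter, Finset.mem_singleton]
        exact ⟨fun h => h.2, fun h => ⟨h ▸ hgmem, h⟩⟩
      have hzero : ∑ δ ∈ ℓ.divisors.filter (fun δ => ¬ δ = g), (δ : ℝ) / Real.sqrt ((ℓ : ℝ) * ℓ') *
          (d n * ind ℓ ℓ' δ n * w ℓ ℓ' δ M n) = 0 := by
        refine Finset.sum_eq_zero fun δ hδ => ?_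
        have hne : ¬ δ = g := (Finset.mem_filter.1 hδ).2
        have : ind ℓ ℓ' δ n = 0 := by
          simp only [hind]
          rw [if_neg]
          rw [← hg]
          exact fun h => hne h.symm
        rw [this, mul_zero, zero_mul, mul_zero]
      rw [hfilter, Finset.sum_singleton, hzero, add_zero]
      have hind1 : ind ℓ ℓ' g n = 1 := by simp only [hind, ← hg, if_true]
      have hmax : (max n 1 : ℕ) = n := max_eq_left hn1
      simp only [hw, hX, hd, hind1, mul_one, hmax]
      field_simp
    rw [Finset.sum_congr rfl hterm, ← Finset.mul_sum, Finset.sum_comm]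
    congr 1
    refine Finset.sum_congr rfl fun δ _ => ?_
    rw [← Finset.mul_sum]
    congr 1
    -- `Icc 1 K` versus `range (K+1)`
    refine (Design.sum_Icc_eq_sum_range (fun n => d n * ind ℓ ℓ' δ n * w ℓ ℓ' δ M n) ?_ (3 * L * M)).trans rfl
    simp [hd]
  -- (2) the class-constant term
  have hS' : |∑ n ∈ Finset.Icc 1 (3 * L * M), (c n - Λ n) * (S (Nat.gcd (n * ℓ') ℓ) / n)| ≤
      Cst * (∑ δ ∈ ℓ.divisors, K δ) * Real.log M ^ θ := by
    have hsplit : ∑ n ∈ Finset.Icc 1 (3 * L * M), (c n - Λ n) * (S (Nat.gcd (n * ℓ') ℓ) / n) =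
        ∑ δ ∈ ℓ.divisors, S δ * ∑ n ∈ Finset.range (3 * L * M + 1), d n * ind ℓ ℓ' δ n := by
      have hterm : ∀ n ∈ Finset.Icc 1 (3 * L * M), (c n - Λ n) * (S (Nat.gcd (n * ℓ') ℓ) / n) =
          ∑ δ ∈ ℓ.divisors, S δ * (d n * ind ℓ ℓ' δ n) := by
        intro n hn
        have hn1 := (Finset.mem_Icc.1 hn).1
        set g := Nat.gcd (n * ℓ') ℓ with hg
        have hgmem : g ∈ ℓ.divisors := Nat.mem_divisors.2 ⟨Nat.gcd_dvd_right _ _, by omega⟩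
        rw [← Finset.sum_filter_add_sum_filter_not ℓ.divisors (fun δ => δ = g)]
        have hfilter : ℓ.divisors.filter (fun δ => δ = g) = {g} := by
          ext δ
          simp only [Finset.mem_filter, Finset.mem_singleton]
          exact ⟨fun h => h.2, fun h => ⟨h ▸ hgmem, h⟩⟩
        have hzero : ∑ δ ∈ ℓ.divisors.filter (fun δ => ¬ δ = g), S δ * (d n * ind ℓ ℓ' δ n) = 0 := by
          refine Finset.sum_eq_zero fun δ hδ => ?_
          have hne : ¬ δ = g := (Finset.mem_filter.1 hδ).2
          have : ind ℓ ℓ' δ n = 0 := by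
            simp only [hind]
            rw [if_neg]
            rw [← hg]
            exact fun h => hne h.symm
          rw [this, mul_zero, mul_zero]
        rw [hfilter, Finset.sum_singleton, hzero, add_zero]
        have hind1 : ind ℓ ℓ' g n = 1 := by simp only [hind, ← hg, if_true]
        simp only [hd, hind1, mul_one]
        ring
      rw [Finset.sum_congr rfl hterm, Finset.sum_comm]
      refine Finset.sum_congr rfl fun δ _ => ?_
      rw [← Finset.mul_sum]
      congr 1
      refine (Design.sum_Icc_eq_sum_range (fun n => d n * ind ℓ ℓ' δ n) ?_ (3 * L * M)).trans rfl
      simp [hd]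
    rw [hsplit]
    refine (Finset.abs_sum_le_sum_abs _ _).trans ?_
    rw [Finset.mul_sum, Finset.sum_mul]
    refine Finset.sum_le_sum fun δ _ => ?_
    rw [abs_mul]
    have h1 := hS δ
    have h2 := hK δ (3 * L * M + 1)
    calc |S δ| * |∑ n ∈ Finset.range (3 * L * M + 1), d n * ind ℓ ℓ' δ n|
        ≤ (Cst * Real.log M ^ θ) * K δ := mul_le_mul h1 h2 (abs_nonneg _) (le_trans (abs_nonneg _) h1)
      _ = Cst * K δ * Real.log M ^ θ := by ring
  -- assemble: `DIFF − A = (DIFF − deep − Sterm) + (Sterm)` with `deep = A`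
  have hlogθ : 0 ≤ Real.log M ^ θ := Real.rpow_nonneg hlog.le θ
  have hCst0 : 0 ≤ Cst * Real.log M ^ θ := le_trans (abs_nonneg _) (hS 0)
  have hsplit : ∑ n ∈ Finset.Icc 1 (3 * L * M), (c n - Λ n) *
        (B₀ * (Real.sqrt ℓ / Real.sqrt ℓ') *
            (∑ k' ∈ Finset.Icc 1 (⌊(M : ℝ) / (4 * Real.sqrt (Real.log M)) / ((n : ℝ) * ℓ')⌋₊),
              (if ℓ ∣ n * ℓ' * k' then (1 : ℝ) / k' else 0)) / n +
          S (Nat.gcd (n * ℓ') ℓ) / n) =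
      (∑ n ∈ Finset.Icc 1 (3 * L * M), (c n - Λ n) *
        (B₀ * (Real.sqrt ℓ / Real.sqrt ℓ') *
            (∑ k' ∈ Finset.Icc 1 (⌊(M : ℝ) / (4 * Real.sqrt (Real.log M)) / ((n : ℝ) * ℓ')⌋₊),
              (if ℓ ∣ n * ℓ' * k' then (1 : ℝ) / k' else 0)) / n)) +
      ∑ n ∈ Finset.Icc 1 (3 * L * M), (c n - Λ n) * (S (Nat.gcd (n * ℓ') ℓ) / n) := by
    rw [← Finset.sum_add_distrib]
    exact Finset.sum_congr rfl fun n _ => by ring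
  rw [hsplit, hdeep] at hpd
  have h3 := abs_le.1 hpd
  have h4 := abs_le.1 hS'
  rw [abs_le]
  constructor <;> nlinarith [h3.1, h3.2, h4.1, h4.2, hCst0,
    Finset.sum_nonneg (fun δ (_ : δ ∈ ℓ.divisors) => le_trans (abs_nonneg _) (hK δ 0))]

/-- **Anchor `combTypePairBoundOfPairData`** (registered sub-goal; `pair_bound_of_pairData` with explicit quantifiers): the
pair-level interface — a two-sided pair bound against the deep term and a class term gives the pair bound. [folklore] -/
theorem combTypePairBoundOfPairData : ∀ c : ℕ → ℝ, (∀ n, 0 ≤ c n) → ∀ L M ℓ ℓ' : ℕ, (ℓ ∈ Finset.Icc 1 L) → (ℓ' ∈ Finset.Icc 1 L) → (0 < Real.log M) → ∀ B₀ Cst θ : ℝ, ∀ V : ℕ → ℕ → ℕ → ℕ → ℝ, ∀ S : ℕ → ℝ, (∀ δ, |S δ| ≤ Cst * Real.log M ^ θ) → (|((∑ n ∈ Finset.Icc 1 (3 * L * M), c n * V M ℓ ℓ' n) - ∑ n ∈ Finset.Icc 1 (3 * L * M), (ArithmeticFunction.vonMangoldt n : ℝ) * V M ℓ ℓ' n)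 - ∑ n ∈ Finset.Icc 1 (3 * L * M), (c n - ArithmeticFunction.vonMangoldt n) * (B₀ * (Real.sqrt ℓ / Real.sqrt ℓ') * (∑ k' ∈ Finset.Icc 1 (⌊(M : ℝ) / (4 * Real.sqrt (Real.log M)) / ((n : ℝ) * ℓ')⌋₊), (if ℓ ∣ n * ℓ' * k' then (1 : ℝ) / k' else 0)) / n + S (Nat.gcd (n * ℓ') ℓ) / n)| ≤ Cst * Real.log M ^ θ) → ∀ K : ℕ → ℝ, (∀ δ N, |∑ n ∈ Finset.range N, (c n - ArithmeticFunction.vonMangoldt n) / n * (if Nat.gcd (n * ℓ') ℓ = δ then (1 : ℝ) else 0)| ≤ K δ) → |((∑ n ∈ Finset.Icc 1 (3 * L * M), c n * V M ℓ ℓ' n) - ∑ n ∈ Finset.Icc 1 (3 * L * M), (ArithmeticFunction.vonMangoldt n : ℝ) * V M ℓ ℓ' n) - B₀ * Real.log M * (∑ δ ∈ ℓ.divisors, (δ : ℝ) / Real.sqrt ((ℓ : ℝ) * ℓ') * ∑ n ∈ Finset.range (3 * L * M + 1), (c n - ArithmeticFunction.vonMangoldt n) / n * (if Nat.gcd (n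 * ℓ') ℓ = δ then (1 : ℝ) else 0) * ((∑ j ∈ Finset.Icc 1 (⌊(M : ℝ) / (4 * Real.sqrt (Real.log M)) / ((max n 1 : ℕ) * ℓ')⌋₊ / (ℓ / δ)), (1 : ℝ) / j) / Real.log M))| ≤ (Cst * (∑ δ ∈ ℓ.divisors, K δ) + Cst + Cst) * Real.log M ^ θ :=
  fun _ _ _ _ _ _ hℓ hℓ' hlog _ _ _ V S hS hpd K hK =>
    pair_bound_of_pairData hℓ hℓ' hlog V S hS hpd K hK

end CombType

end Summit.RiemannHypothesis.RiemannHypothesis.Theorems.SignConeConeMagnification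

end
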